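import Summits.Ventures.PercRepro.S2FlatTailBounds16

/-!
# PercRepro — S2: THE FLAT-TAIL BOUNDS FOR THE PARTITION CHAIN (p7, gen 2; sub-claim S2)

`16·(Fl(n) + Σ_{j ≤ J} C(n, j)) ≤ 2^n` from `(J, n₀) = (11, 37), (13, 39), (16, 44), (18, 48), (19, 50)` (the coranks
`d ≤ 19` of the cells `(p, d)`, `p ≥ 32`) and `8·(Fl(n) + Σ_{j ≤ J} C(n, j)) ≤ 2^n` from `(J, n₀) = (20, 50), (21, 52),
(22, 54), (23, 56), (24, 58), (25, 60)` (the coranks `20 … 25`, the `7/8` form); each by `Nat.le_induction` from a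
decided base. Axioms: standard.
-/

namespace PercRepro

namespace S2

/-- `16·(Fl(n) + Σ_{j ≤ 11} C(n, j)) ≤ 2^n` for `n ≥ 37`. -/
theorem sixteen_mul_tail_eleven' (n : ℕ) (hn : 37 ≤ n) :
    16 * (flatTail n + ∑ j ∈ Finset.range (11 + 1), n.choose j) ≤ 2 ^ n := by
  induction n, hn using Nat.le_induction with
  | base =>
    unfold flatTail
    simp only [Finset.sum_range_succ, Finset.sum_range_zero]
    norm_num [Nat.choose]
  | succ n hn ih =>
    have h := tail_succ_le n 11 (by omega)
    rw [pow_succ]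
    omega

/-- `16·(Fl(n) + Σ_{j ≤ 13} C(n, j)) ≤ 2^n` for `n ≥ 39`. -/
theorem sixteen_mul_tail_thirteen' (n : ℕ) (hn : 39 ≤ n) :
    16 * (flatTail n + ∑ j ∈ Finset.range (13 + 1), n.choose j) ≤ 2 ^ n := by
  induction n, hn using Nat.le_induction with
  | base =>
    unfold flatTail
    simp only [Finset.sum_range_succ, Finset.sum_range_zero]
    norm_num [Nat.choose]
  | succ n hn ih =>
    have h := tail_succ_le n 13 (by omega)
    rw [pow_succ]
    omega

/-- `16·(Fl(n) + Σ_{j ≤ 16} C(n, j)) ≤ 2^n` for `n ≥ 44`. -/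
theorem sixteen_mul_tail_sixteen' (n : ℕ) (hn : 44 ≤ n) :
    16 * (flatTail n + ∑ j ∈ Finset.range (16 + 1), n.choose j) ≤ 2 ^ n := by
  induction n, hn using Nat.le_induction with
  | base =>
    unfold flatTail
    simp only [Finset.sum_range_succ, Finset.sum_range_zero]
    norm_num [Nat.choose]
  | succ n hn ih =>
    have h := tail_succ_le n 16 (by omega)
    rw [pow_succ]
    omega

/-- `16·(Fl(n) + Σ_{j ≤ 18} C(n, j)) ≤ 2^n` for `n ≥ 48`. -/
theorem sixteen_mul_tail_eighteen' (n : ℕ) (hn : 48 ≤ n) :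
    16 * (flatTail n + ∑ j ∈ Finset.range (18 + 1), n.choose j) ≤ 2 ^ n := by
  induction n, hn using Nat.le_induction with
  | base =>
    unfold flatTail
    simp only [Finset.sum_range_succ, Finset.sum_range_zero]
    norm_num [Nat.choose]
  | succ n hn ih =>
    have h := tail_succ_le n 18 (by omega)
    rw [pow_succ]
    omega

/-- `16·(Fl(n) + Σ_{j ≤ 19} C(n, j)) ≤ 2^n` for `n ≥ 50`. -/
theorem sixteen_mul_tail_nineteen' (n : ℕ) (hn : 50 ≤ n) :
    16 * (flatTail n + ∑ j ∈ Finset.range (19 + 1), n.choose j) ≤ 2 ^ n := by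
  induction n, hn using Nat.le_induction with
  | base =>
    unfold flatTail
    simp only [Finset.sum_range_succ, Finset.sum_range_zero]
    norm_num [Nat.choose]
  | succ n hn ih =>
    have h := tail_succ_le n 19 (by omega)
    rw [pow_succ]
    omega

/-- `8·(Fl(n) + Σ_{j ≤ 20} C(n, j)) ≤ 2^n` for `n ≥ 50`. -/
theorem eight_mul_tail_twenty (n : ℕ) (hn : 50 ≤ n) :
    8 * (flatTail n + ∑ j ∈ Finset.range (20 + 1), n.choose j) ≤ 2 ^ n := by
  induction n, hn using Nat.le_induction with
  | base =>
    unfold flatTail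
    simp only [Finset.sum_range_succ, Finset.sum_range_zero]
    norm_num [Nat.choose]
  | succ n hn ih =>
    have h := tail_succ_le n 20 (by omega)
    rw [pow_succ]
    omega

/-- `8·(Fl(n) + Σ_{j ≤ 21} C(n, j)) ≤ 2^n` for `n ≥ 52`. -/
theorem eight_mul_tail_twentyone (n : ℕ) (hn : 52 ≤ n) :
    8 * (flatTail n + ∑ j ∈ Finset.range (21 + 1), n.choose j) ≤ 2 ^ n := by
  induction n, hn using Nat.le_induction with
  | base =>
    unfold flatTail
    simp only [Finset.sum_range_succ, Finset.sum_range_zero]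
    norm_num [Nat.choose]
  | succ n hn ih =>
    have h := tail_succ_le n 21 (by omega)
    rw [pow_succ]
    omega

/-- `8·(Fl(n) + Σ_{j ≤ 22} C(n, j)) ≤ 2^n` for `n ≥ 54`. -/
theorem eight_mul_tail_twentytwo (n : ℕ) (hn : 54 ≤ n) :
    8 * (flatTail n + ∑ j ∈ Finset.range (22 + 1), n.choose j) ≤ 2 ^ n := by
  induction n, hn using Nat.le_induction with
  | base =>
    unfold flatTail
    simp only [Finset.sum_range_succ, Finset.sum_range_zero]
    norm_num [Nat.choose]
  | succ n hn ih =>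
    have h := tail_succ_le n 22 (by omega)
    rw [pow_succ]
    omega

/-- `8·(Fl(n) + Σ_{j ≤ 23} C(n, j)) ≤ 2^n` for `n ≥ 56`. -/
theorem eight_mul_tail_twentythree (n : ℕ) (hn : 56 ≤ n) :
    8 * (flatTail n + ∑ j ∈ Finset.range (23 + 1), n.choose j) ≤ 2 ^ n := by
  induction n, hn using Nat.le_induction with
  | base =>
    unfold flatTail
    simp only [Finset.sum_range_succ, Finset.sum_range_zero]
    norm_num [Nat.choose]
  | succ n hn ih =>
    have h := tail_succ_le n 23 (by omega)
    rw [pow_succ]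
    omega

/-- `8·(Fl(n) + Σ_{j ≤ 24} C(n, j)) ≤ 2^n` for `n ≥ 58`. -/
theorem eight_mul_tail_twentyfour (n : ℕ) (hn : 58 ≤ n) :
    8 * (flatTail n + ∑ j ∈ Finset.range (24 + 1), n.choose j) ≤ 2 ^ n := by
  induction n, hn using Nat.le_induction with
  | base =>
    unfold flatTail
    simp only [Finset.sum_range_succ, Finset.sum_range_zero]
    norm_num [Nat.choose]
  | succ n hn ih =>
    have h := tail_succ_le n 24 (by omega)
    rw [pow_succ]
    omega

/-- `8·(Fl(n) + Σ_{j ≤ 25} C(n, j)) ≤ 2^n` for `n ≥ 60`. -/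
theorem eight_mul_tail_twentyfive (n : ℕ) (hn : 60 ≤ n) :
    8 * (flatTail n + ∑ j ∈ Finset.range (25 + 1), n.choose j) ≤ 2 ^ n := by
  induction n, hn using Nat.le_induction with
  | base =>
    unfold flatTail
    simp only [Finset.sum_range_succ, Finset.sum_range_zero]
    norm_num [Nat.choose]
  | succ n hn ih =>
    have h := tail_succ_le n 25 (by omega)
    rw [pow_succ]
    omega

end S2

end PercRepro
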